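import Literature.AlgebraicGeometry.HodgeTheory.ConjugationChartUniqueness
import Literature.AlgebraicGeometry.HodgeTheory.HodgeTypeConjugation
import Literature.AlgebraicGeometry.HodgeTheory.ComplexConjugationHolds
import HarnessLib

/-!
# Consequences of `chartConjugation_canonical`: conjugate classes are unique, functorial and additive;
# absolute Hodge classes form a `ℚ`-subspace

`ConjugationChartUniqueness` names the printed input (Charles–Schnell §11.2.2 (11.2.2)–(11.2.3) with
Grothendieck's comparison) under which the tree's chart-wise conjugation `IsConjugateClass σ X k c c'`
(an `∃` over conjugation charts, `AbsoluteHodgeClasses`) is the canonical `α ↦ α^σ`. This file derives the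
working calculus, all CONDITIONAL on that fact `hN` (and, where a conjugate must be produced, on the
existence of conjugates, e.g. `exists_isConjugateClass_of_facts'`):

* `ConjugationChart.conjugates_eq_of_canonical_spec` — every chart on a smooth projective variety computes
  the canonical conjugate; packaged as `exists_canonical_spec` (a `θ` which is `σ`-semilinear, natural for
  morphisms of smooth projective varieties, and equal to every chart conjugate);
* `IsConjugateClass.unique_of_canonical`, `.eq_map_of_canonical` (naturality: a conjugate of `g^* c` is
  `(g^σ)^*` of a conjugate of `c`), `.map_of_canonical`;
* `IsConjugateClass.eq_add_of_canonical`, `.eq_smul_of_canonical`, `.eq_zero_of_canonical` — conjugation is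
  additive, `σ`-semilinear, and kills `0`;
* `IsAbsoluteHodgeClass.add_of_canonical`, `.smul_rat_of_canonical`, `.neg_of_canonical`,
  `.sub_of_canonical`, `isAbsoluteHodgeClass_zero_of_canonical` — absolute Hodge classes
  (Charles–Schnell Def. 11.2.3) form a `ℚ`-subspace of `H²ᵖ(X(ℂ); ℂ)`, granted existence of conjugates.
-/

noncomputable section

open CategoryTheory AlgebraicGeometry
open scoped Manifold ContDiff
open Literature.AlgebraicGeometry.Motives
open Literature.NumberTheory.Transcendental Literature.Geometry.Kaehler

namespace Literature.AlgebraicGeometry.HodgeTheory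

section HodgeTheory

variable {σ : ℂ ≃+* ℂ} {k : ℕ}

/-- **Every conjugation chart computes the canonical conjugate** (from clauses (ii)–(iii) of
`chartConjugation_canonical`, for a given `θ`): for a chart `D` on a smooth projective `Z` and
`D.Conjugates a a'`, `a' = θ_Z a` — the chart's expression `ξ` gives `A'^*(θ (π^* a)) = e[ξ^σ] = A'^*((π^σ)^* a')`,
`A'^*` is injective, `θ (π^* a) = (π^σ)^* (θ a)` by naturality, and `(π^σ)^*` is injective.
[cite: CharlesSchnell2014Notes, §11.2.2 (11.2.3)] -/
theorem ConjugationChart.conjugates_eq_of_canonical_spec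
    (θ : ∀ X : SchemeOver ℂ, complexBetti X k → complexBetti (conjugateVariety σ X) k)
    (hnat : ∀ ⦃n : ℕ⦄ ⦃X : SchemeOver ℂ⦄, IsSmoothProjective n X →
        ∀ ⦃Y : SchemeOver ℂ⦄ (g : Y ⟶ X),
          ((∃ m, IsSmoothProjective m Y) ∨ (_root_.AlgebraicGeometry.IsAffine Y.left ∧
            ∃ m, _root_.AlgebraicGeometry.SmoothOfRelativeDimension m Y.hom)) →
          ∀ c : complexBetti X k, θ Y (complexBetti.map g k c) = complexBetti.map (conjHom σ g) k (θ X c))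
    (hchart : ∀ (E : Type) [NormedAddCommGroup E] [NormedSpace ℂ E] [FiniteDimensional ℂ E]
        (e : ComplexDeRhamIsoFamily E), e.IsNatural → IsRationalDeRhamFamily e k →
        ∀ (m : ℕ) (Y : SchemeOver ℂ) [_root_.AlgebraicGeometry.IsAffine Y.left]
          [_root_.AlgebraicGeometry.SmoothOfRelativeDimension m Y.hom]
          (A : AnalyticModel E m Y) (A' : AnalyticModel E m (conjugateVariety σ Y))
          (ξ : AlgFormExpr Y k) (hξ : ξ.realize A ∈ cclosedSmoothForms E A.carrier k)
          (hξ' : (ξ.conj σ).realize A' ∈ cclosedSmoothForms E A'.carrier k) (c : complexBetti Y k),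
          A.pullback k c = e A.carrier k (complexDeRhamCohomology.mk E A.carrier k ⟨_, hξ⟩) →
          A'.pullback k (θ Y c) =
            e A'.carrier k (complexDeRhamCohomology.mk E A'.carrier k ⟨_, hξ'⟩))
    {n : ℕ} {Z : SchemeOver ℂ} (hZ : IsSmoothProjective n Z) (D : ConjugationChart σ Z k)
    {a : complexBetti Z k} {a' : complexBetti (conjugateVariety σ Z) k} (h : D.Conjugates a a') :
    a' = θ Z a := by
  obtain ⟨ξ, hξ, hξ', h₁, h₂⟩ := h
  have hθ : D.anConj.pullback k (θ D.Y (complexBetti.map D.π k a)) =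
      D.anConj.pullback k (complexBetti.map (conjHom σ D.π) k a') := by
    rw [h₂]
    exact hchart D.E D.deRham D.deRham_isNatural D.deRham_isRational D.m D.Y D.an D.anConj ξ hξ hξ'
      (complexBetti.map D.π k a) h₁
  have hθ' : θ D.Y (complexBetti.map D.π k a) = complexBetti.map (conjHom σ D.π) k a' :=
    D.anConj.pullback_injective k hθ
  rw [hnat hZ D.π (Or.inr ⟨D.isAffine, D.m, D.smooth⟩)] at hθ'
  exact (D.injective_map hθ').symm

/-- **The canonical conjugation, repackaged for smooth projective varieties.** Granted
`chartConjugation_canonical`, for each `σ`, `k` there is `θ` with: `θ_X` `σ`-semilinear; natural for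
morphisms `g : Y ⟶ X` of smooth projective varieties; and EQUAL TO EVERY CHART CONJUGATE:
`IsConjugateClass σ Z k c c' → c' = θ_Z c` for `Z` smooth projective.
[cite: CharlesSchnell2014Notes, §11.2.2 (11.2.2)–(11.2.3)] -/
theorem exists_canonical_spec (hN : chartConjugation_canonical) (σ : ℂ ≃+* ℂ) (k : ℕ) :
    ∃ θ : ∀ X : SchemeOver ℂ, complexBetti X k → complexBetti (conjugateVariety σ X) k,
      (∀ (X : SchemeOver ℂ) (a : ℂ) (c₁ c₂ : complexBetti X k),
          θ X (a • c₁ + c₂) = σ a • θ X c₁ + θ X c₂) ∧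
      (∀ ⦃n : ℕ⦄ ⦃X : SchemeOver ℂ⦄, IsSmoothProjective n X → ∀ ⦃m : ℕ⦄ ⦃Y : SchemeOver ℂ⦄,
        IsSmoothProjective m Y → ∀ (g : Y ⟶ X) (c : complexBetti X k),
          θ Y (complexBetti.map g k c) = complexBetti.map (conjHom σ g) k (θ X c)) ∧
      (∀ ⦃n : ℕ⦄ ⦃Z : SchemeOver ℂ⦄, IsSmoothProjective n Z →
        ∀ ⦃c : complexBetti Z k⦄ ⦃c' : complexBetti (conjugateVariety σ Z) k⦄,
          IsConjugateClass σ Z k c c' → c' = θ Z c) := by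
  obtain ⟨θ, hlin, hnat, hchart⟩ := hN σ k
  refine ⟨θ, hlin, fun n X hX m Y hY g c ↦ hnat hX g (Or.inl ⟨m, hY⟩) c, fun n Z hZ c c' h ↦ ?_⟩
  obtain ⟨D, hD⟩ := h
  exact ConjugationChart.conjugates_eq_of_canonical_spec θ hnat hchart hZ D hD

/-! ### Conjugate classes: uniqueness, naturality, linearity -/

/-- **Conjugates are unique** on a smooth projective variety, granted `chartConjugation_canonical`: two
conjugates of one class, in any two charts, coincide. [cite: CharlesSchnell2014Notes, §11.2.2 (11.2.3)] -/
theorem IsConjugateClass.unique_of_canonical (hN : chartConjugation_canonical) {n : ℕ}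
    {X : SchemeOver ℂ} (hX : IsSmoothProjective n X) {c : complexBetti X k}
    {c₁ c₂ : complexBetti (conjugateVariety σ X) k} (h₁ : IsConjugateClass σ X k c c₁)
    (h₂ : IsConjugateClass σ X k c c₂) : c₁ = c₂ := by
  obtain ⟨θ, -, -, heq⟩ := exists_canonical_spec hN σ k
  rw [heq hX h₁, heq hX h₂]

/-- **Naturality of conjugation** (granted `chartConjugation_canonical`): for a morphism `g : Y ⟶ X` of
smooth projective varieties, a conjugate `c'` of `c` and a conjugate `d'` of `g^* c` satisfy
`d' = (g^σ)^* c'`. This is the σ-infrastructure statement `ConjugateNaturality` of the absolute-Hodge lines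
of the Hodge programme. [cite: CharlesSchnell2014Notes, §11.2.2 (11.2.2)–(11.2.3)] -/
theorem IsConjugateClass.eq_map_of_canonical (hN : chartConjugation_canonical) {m n : ℕ}
    {Y X : SchemeOver ℂ} (hY : IsSmoothProjective m Y) (hX : IsSmoothProjective n X) (g : Y ⟶ X)
    {c : complexBetti X k} {c' : complexBetti (conjugateVariety σ X) k}
    {d' : complexBetti (conjugateVariety σ Y) k} (hc' : IsConjugateClass σ X k c c')
    (hd' : IsConjugateClass σ Y k (complexBetti.map g k c) d') :
    d' = complexBetti.map (conjHom σ g) k c' := by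
  obtain ⟨θ, -, hnat, heq⟩ := exists_canonical_spec hN σ k
  rw [heq hY hd', heq hX hc', hnat hX hY g c]

/-- **Conjugates pull back to conjugates** (granted `chartConjugation_canonical`): if `c'` is a conjugate
of `c` on `X` and `g^* c` has some conjugate on `Y`, then `(g^σ)^* c'` is a conjugate of `g^* c`.
[cite: CharlesSchnell2014Notes, §11.2.2 (11.2.2)–(11.2.3)] -/
theorem IsConjugateClass.map_of_canonical (hN : chartConjugation_canonical) {m n : ℕ}
    {Y X : SchemeOver ℂ} (hY : IsSmoothProjective m Y) (hX : IsSmoothProjective n X) (g : Y ⟶ X)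
    {c : complexBetti X k} {c' : complexBetti (conjugateVariety σ X) k}
    (hc' : IsConjugateClass σ X k c c') (hex : ∃ d', IsConjugateClass σ Y k (complexBetti.map g k c) d') :
    IsConjugateClass σ Y k (complexBetti.map g k c) (complexBetti.map (conjHom σ g) k c') := by
  obtain ⟨d', hd'⟩ := hex
  obtain rfl : d' = complexBetti.map (conjHom σ g) k c' :=
    IsConjugateClass.eq_map_of_canonical hN hY hX g hc' hd'
  exact hd'

/-- **Conjugation is additive** (granted `chartConjugation_canonical`): a conjugate of `c + d` is the sum
of conjugates of `c` and `d`. [cite: CharlesSchnell2014Notes, §11.2.2 (11.2.3)] -/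
theorem IsConjugateClass.eq_add_of_canonical (hN : chartConjugation_canonical) {n : ℕ}
    {X : SchemeOver ℂ} (hX : IsSmoothProjective n X) {c d : complexBetti X k}
    {c' d' s : complexBetti (conjugateVariety σ X) k} (hc : IsConjugateClass σ X k c c')
    (hd : IsConjugateClass σ X k d d') (hs : IsConjugateClass σ X k (c + d) s) : s = c' + d' := by
  obtain ⟨θ, hlin, -, heq⟩ := exists_canonical_spec hN σ k
  rw [heq hX hs, heq hX hc, heq hX hd]
  have h := hlin X 1 c d
  rw [one_smul, map_one, one_smul] at h
  exact h

/-- **Conjugation is `σ`-semilinear** (granted `chartConjugation_canonical`): a conjugate of `a • c` is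
`σ a •` a conjugate of `c` (`(λα)^σ = σ(λ) α^σ`). [cite: CharlesSchnell2014Notes, §11.2.2 (11.2.3)] -/
theorem IsConjugateClass.eq_smul_of_canonical (hN : chartConjugation_canonical) {n : ℕ}
    {X : SchemeOver ℂ} (hX : IsSmoothProjective n X) (a : ℂ) {c : complexBetti X k}
    {c' s : complexBetti (conjugateVariety σ X) k} (hc : IsConjugateClass σ X k c c')
    (hs : IsConjugateClass σ X k (a • c) s) : s = σ a • c' := by
  obtain ⟨θ, hlin, -, heq⟩ := exists_canonical_spec hN σ k
  have h0 : θ X 0 = 0 := by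
    have h := hlin X 1 0 0
    rw [smul_zero, zero_add, map_one, one_smul] at h
    have h' : (0 : complexBetti (conjugateVariety σ X) k) + θ X 0 = θ X 0 + θ X 0 := by
      rw [zero_add]; exact h
    exact (add_right_cancel h').symm
  rw [heq hX hs, heq hX hc]
  have h := hlin X a c 0
  rw [add_zero, h0, add_zero] at h
  exact h

/-- **The conjugate of `0` is `0`** (granted `chartConjugation_canonical`).
[cite: CharlesSchnell2014Notes, §11.2.2 (11.2.3)] -/
theorem IsConjugateClass.eq_zero_of_canonical (hN : chartConjugation_canonical) {n : ℕ}
    {X : SchemeOver ℂ} (hX : IsSmoothProjective n X) {s : complexBetti (conjugateVariety σ X) k}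
    (hs : IsConjugateClass σ X k 0 s) : s = 0 := by
  have hs' : IsConjugateClass σ X k ((0 : ℂ) • (0 : complexBetti X k)) s := by rwa [zero_smul]
  have h := IsConjugateClass.eq_smul_of_canonical hN hX 0 hs hs'
  rwa [map_zero, zero_smul] at h

/-! ### What the fact contains: Grothendieck's kernel statement, transported by `σ` -/

/-- **The canonical `θ` kills `0`** (clause (i) at `a = 1`, `c₁ = c₂ = 0`). [folklore] -/
theorem chartConjugation_apply_zero
    {θ : ∀ X : SchemeOver ℂ, complexBetti X k → complexBetti (conjugateVariety σ X) k}
    (hlin : ∀ (X : SchemeOver ℂ) (a : ℂ) (c₁ c₂ : complexBetti X k),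
      θ X (a • c₁ + c₂) = σ a • θ X c₁ + θ X c₂)
    (X : SchemeOver ℂ) : θ X 0 = 0 := by
  have h := hlin X 1 0 0
  rw [smul_zero, zero_add, map_one, one_smul] at h
  exact add_left_cancel (h.symm.trans (add_zero _).symm)

/-- **`chartConjugation_canonical` contains the injectivity of Grothendieck's comparison map, transported
by `σ`.** Granted the fact: for `Y` smooth affine over `ℂ`, analytic models `A` of `Y` and `A'` of `Y^σ`
charted on one model space `E`, a natural complex de Rham family `e` on `E`-manifolds rationally
normalised in degree `k`, and an algebraic `k`-form expression `ξ` on `Y` with closed realisations — if the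
de Rham class of `ξ.realize A` on `Y^an` VANISHES, then so does the class of the conjugate realisation
`(ξ.conj σ).realize A'` on `(Y^σ)^an` (clause (iii) at `c = 0`: `A^* 0 = 0 = e[ξ.realize A]`, so
`e[(ξ.conj σ).realize A'] = A'^* (θ_Y 0) = 0`, and `e` is injective). In print this is the INJECTIVITY half of
Grothendieck's comparison isomorphism `H•(Γ(Y, Ω•_{Y/ℂ})) ⥲ H•(Y^an; ℂ)` (Grothendieck 1966, Thm. 1′: a closed
regular form with vanishing complex class is `dη`, `η` regular) carried along Charles–Schnell's `σ`-linear
isomorphism of algebraic de Rham complexes `α ↦ α^σ` ((11.2.2): `(dη)^σ = d(η^σ)`); the tree states only the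
surjectivity half (`grothendieck_comparison_realize_surjective`), so this records the kernel statement every
proof of the fact must supply. [cite: CharlesSchnell2014Notes, §11.2.2 (11.2.2)–(11.2.3)]
[cite: Grothendieck1966deRham, Thm. 1′] -/
theorem complexDeRhamCohomology_mk_conj_eq_zero_of_canonical (hN : chartConjugation_canonical)
    (σ : ℂ ≃+* ℂ) (k : ℕ) {E : Type} [NormedAddCommGroup E] [NormedSpace ℂ E] [FiniteDimensional ℂ E]
    {e : ComplexDeRhamIsoFamily E} (he : e.IsNatural) (hr : IsRationalDeRhamFamily e k)
    {m : ℕ} {Y : SchemeOver ℂ} [_root_.AlgebraicGeometry.IsAffine Y.left]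
    [_root_.AlgebraicGeometry.SmoothOfRelativeDimension m Y.hom]
    (A : AnalyticModel E m Y) (A' : AnalyticModel E m (conjugateVariety σ Y))
    (ξ : AlgFormExpr Y k) (hξ : ξ.realize A ∈ cclosedSmoothForms E A.carrier k)
    (hξ' : (ξ.conj σ).realize A' ∈ cclosedSmoothForms E A'.carrier k)
    (h0 : complexDeRhamCohomology.mk E A.carrier k ⟨_, hξ⟩ = 0) :
    complexDeRhamCohomology.mk E A'.carrier k ⟨_, hξ'⟩ = 0 := by
  obtain ⟨θ, hlin, -, hchart⟩ := hN σ k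
  have h := hchart E e he hr m Y A A' ξ hξ hξ' 0 (by rw [map_zero, h0, map_zero])
  rw [chartConjugation_apply_zero hlin, map_zero] at h
  exact (e A'.carrier k).map_eq_zero_iff.mp h.symm

/-- **Equal classes have conjugates with equal classes** (granted the fact): if two algebraic `k`-form
expressions `ξ₁`, `ξ₂` on the smooth affine `Y` realise, on `Y^an`, closed forms with the SAME de Rham class,
and `c` is read through `ξ₁` (`A^* c = e[ξ₁.realize A]`), then `θ`'s value is read equally through `ξ₂^σ`:
both `e[(ξ₁.conj σ).realize A']` and `e[(ξ₂.conj σ).realize A']` equal `A'^* (θ_Y c)`. This is the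
well-definedness of `α ↦ α^σ` on cohomology (Charles–Schnell (11.2.3)) as a constraint met by the fact.
[cite: CharlesSchnell2014Notes, §11.2.2 (11.2.3)] -/
theorem chartConjugation_conj_wellDefined_of_canonical (hN : chartConjugation_canonical)
    (σ : ℂ ≃+* ℂ) (k : ℕ) {E : Type} [NormedAddCommGroup E] [NormedSpace ℂ E] [FiniteDimensional ℂ E]
    {e : ComplexDeRhamIsoFamily E} (he : e.IsNatural) (hr : IsRationalDeRhamFamily e k)
    {m : ℕ} {Y : SchemeOver ℂ} [_root_.AlgebraicGeometry.IsAffine Y.left]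
    [_root_.AlgebraicGeometry.SmoothOfRelativeDimension m Y.hom]
    (A : AnalyticModel E m Y) (A' : AnalyticModel E m (conjugateVariety σ Y))
    (ξ₁ ξ₂ : AlgFormExpr Y k) (h₁ : ξ₁.realize A ∈ cclosedSmoothForms E A.carrier k)
    (h₂ : ξ₂.realize A ∈ cclosedSmoothForms E A.carrier k)
    (h₁' : (ξ₁.conj σ).realize A' ∈ cclosedSmoothForms E A'.carrier k)
    (h₂' : (ξ₂.conj σ).realize A' ∈ cclosedSmoothForms E A'.carrier k)
    (heq : complexDeRhamCohomology.mk E A.carrier k ⟨_, h₁⟩ = complexDeRhamCohomology.mk E A.carrier k ⟨_, h₂⟩) :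
    e A'.carrier k (complexDeRhamCohomology.mk E A'.carrier k ⟨_, h₁'⟩) =
      e A'.carrier k (complexDeRhamCohomology.mk E A'.carrier k ⟨_, h₂'⟩) := by
  obtain ⟨θ, -, -, hchart⟩ := hN σ k
  -- read the class common to `ξ₁`, `ξ₂` in `Hᵏ(Y(ℂ); ℂ)` through the comparison homeomorphism
  obtain ⟨c, hc⟩ := A.pullback_surjective k (e A.carrier k (complexDeRhamCohomology.mk E A.carrier k ⟨_, h₁⟩))
  have e₁ := hchart E e he hr m Y A A' ξ₁ h₁ h₁' c hc
  have e₂ := hchart E e he hr m Y A A' ξ₂ h₂ h₂' c (hc.trans (by rw [heq]))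
  exact e₁.symm.trans e₂

end HodgeTheory

/-! ### Absolute Hodge classes form a `ℚ`-subspace (granted the fact and existence of conjugates) -/

section Absolute

variable {n : ℕ} {X : SchemeOver ℂ} {p : ℕ}

/-- **Sums of absolute Hodge classes are absolute Hodge**, granted `chartConjugation_canonical` and the
existence of conjugates of all classes of `X` (e.g. `exists_isConjugateClass_of_facts'`): a conjugate of
`c + d` is `c' + d' = (2πi/σ(2πi))ᵖ (β + γ)` with `β`, `γ` rational of type `(p,p)`.
[cite: CharlesSchnell2014Notes, Def. 11.2.3] -/
theorem IsAbsoluteHodgeClass.add_of_canonical (hN : chartConjugation_canonical)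
    (hX : IsSmoothProjective n X)
    (hex : ∀ (σ : ℂ ≃+* ℂ) (c : complexBetti X (2 * p)), ∃ c', IsConjugateClass σ X (2 * p) c c')
    {c d : complexBetti X (2 * p)} (hc : IsAbsoluteHodgeClass n X p c)
    (hd : IsAbsoluteHodgeClass n X p d) : IsAbsoluteHodgeClass n X p (c + d) := by
  refine ⟨hc.1.add hd.1, hc.2.1.add hX hd.2.1, fun σ ↦ ⟨hex σ _, fun s hs ↦ ?_⟩⟩
  obtain ⟨c', hc'⟩ := (hc.2.2 σ).1
  obtain ⟨d', hd'⟩ := (hd.2.2 σ).1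
  obtain ⟨β, hβ, hβH, rfl⟩ := (hc.2.2 σ).2 c' hc'
  obtain ⟨γ, hγ, hγH, rfl⟩ := (hd.2.2 σ).2 d' hd'
  refine ⟨β + γ, hβ.add hγ, hβH.add (IsSmoothProjective.conjugateVariety_holds σ hX) hγH, ?_⟩
  rw [IsConjugateClass.eq_add_of_canonical hN hX hc' hd' hs, smul_add]

/-- **Rational multiples of absolute Hodge classes are absolute Hodge**, granted
`chartConjugation_canonical` and existence of conjugates: a conjugate of `q • c` is
`σ(q) • c' = (2πi/σ(2πi))ᵖ (q • β)`, `σ(q) = q`. [cite: CharlesSchnell2014Notes, Def. 11.2.3] -/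
theorem IsAbsoluteHodgeClass.smul_rat_of_canonical (hN : chartConjugation_canonical)
    (hX : IsSmoothProjective n X)
    (hex : ∀ (σ : ℂ ≃+* ℂ) (c : complexBetti X (2 * p)), ∃ c', IsConjugateClass σ X (2 * p) c c')
    {c : complexBetti X (2 * p)} (hc : IsAbsoluteHodgeClass n X p c) (q : ℚ) :
    IsAbsoluteHodgeClass n X p ((q : ℂ) • c) := by
  refine ⟨hc.1.smul q, hc.2.1.smul _, fun σ ↦ ⟨hex σ _, fun s hs ↦ ?_⟩⟩
  obtain ⟨c', hc'⟩ := (hc.2.2 σ).1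
  obtain ⟨β, hβ, hβH, rfl⟩ := (hc.2.2 σ).2 c' hc'
  refine ⟨(q : ℂ) • β, hβ.smul q, hβH.smul _, ?_⟩
  rw [IsConjugateClass.eq_smul_of_canonical hN hX (q : ℂ) hc' hs, map_ratCast, smul_comm]

/-- **Negatives of absolute Hodge classes are absolute Hodge** (granted the fact and existence of
conjugates). [cite: CharlesSchnell2014Notes, Def. 11.2.3] -/
theorem IsAbsoluteHodgeClass.neg_of_canonical (hN : chartConjugation_canonical)
    (hX : IsSmoothProjective n X)
    (hex : ∀ (σ : ℂ ≃+* ℂ) (c : complexBetti X (2 * p)), ∃ c', IsConjugateClass σ X (2 * p) c c')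
    {c : complexBetti X (2 * p)} (hc : IsAbsoluteHodgeClass n X p c) :
    IsAbsoluteHodgeClass n X p (-c) := by
  simpa using hc.smul_rat_of_canonical hN hX hex (-1)

/-- **Differences of absolute Hodge classes are absolute Hodge** (granted the fact and existence of
conjugates). [cite: CharlesSchnell2014Notes, Def. 11.2.3] -/
theorem IsAbsoluteHodgeClass.sub_of_canonical (hN : chartConjugation_canonical)
    (hX : IsSmoothProjective n X)
    (hex : ∀ (σ : ℂ ≃+* ℂ) (c : complexBetti X (2 * p)), ∃ c', IsConjugateClass σ X (2 * p) c c')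
    {c d : complexBetti X (2 * p)} (hc : IsAbsoluteHodgeClass n X p c)
    (hd : IsAbsoluteHodgeClass n X p d) : IsAbsoluteHodgeClass n X p (c - d) := by
  rw [sub_eq_add_neg]
  exact hc.add_of_canonical hN hX hex (hd.neg_of_canonical hN hX hex)

/-- **The zero class is absolute Hodge** (granted the fact and existence of conjugates): every conjugate
of `0` is `0 = (2πi/σ(2πi))ᵖ • 0`, and `0` is rational of type `(p,p)` (Hodge models exist,
`nonempty_hodgeModel_holds`). [cite: CharlesSchnell2014Notes, Def. 11.2.3] -/
theorem isAbsoluteHodgeClass_zero_of_canonical (hN : chartConjugation_canonical)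
    (hX : IsSmoothProjective n X)
    (hex : ∀ (σ : ℂ ≃+* ℂ) (c : complexBetti X (2 * p)), ∃ c', IsConjugateClass σ X (2 * p) c c') :
    IsAbsoluteHodgeClass n X p 0 := by
  refine ⟨IsRationalClass.zero, isOfHodgeType_zero_of_isSmoothProjective nonempty_hodgeModel_holds hX _ _ _,
    fun σ ↦ ⟨hex σ 0, fun s hs ↦ ⟨0, IsRationalClass.zero,
      isOfHodgeType_zero_of_isSmoothProjective nonempty_hodgeModel_holds
        (IsSmoothProjective.conjugateVariety_holds σ hX) _ _ _, ?_⟩⟩⟩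
  rw [IsConjugateClass.eq_zero_of_canonical hN hX hs, smul_zero]

end Absolute

end Literature.AlgebraicGeometry.HodgeTheory

end
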